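import Literature.NumberTheory.GaloisRepresentations.HochschildSerreEdgeNaturality
import Literature.NumberTheory.GaloisRepresentations.ContinuousH1TrivialAction
import Literature.NumberTheory.GaloisRepresentations.PadicCoefficientsTowerTorsion
import HarnessLib

/-!
# `H¹(N, ℤ/lⁱ)` for trivial coefficients and the compatible `E₂^{1,1}`-families `χ ⊗ f`

Let `G` be a profinite group, `N ⊴ G` a closed normal subgroup, and give `ℤ/lⁱ` the TRIVIAL `G`-action.
Then `H¹(N, ℤ/lⁱ) = Hom_cont(N, ℤ/lⁱ)` (continuous crossed homomorphisms of a trivial module are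
continuous homomorphisms and `[·]` is injective, `ContinuousH1TrivialAction.lean`), the `G/N`-action on
it (`hOneRep`, `HochschildSerreLowDegree.lean`) is `(ḡ · f)(n) = f(g⁻¹ n g)`, and a CONJUGATION-INVARIANT
continuous homomorphism `f : N → ℤ/lⁱ` is a `G/N`-fixed vector of `H¹(N, ℤ/lⁱ)`.  For such an `f` and a
continuous additive character `χ : G/N → ℤ/lⁱ`, the map `ḡ ↦ χ(ḡ) · [f]` is a continuous `1`-cocycle of
`G/N` with values in `H¹(N, ℤ/lⁱ)` — the finite-level shadow of the decomposable classes
"`H¹(G, Hom(R_l, ℚ_l)) = H¹(G, ℚ_l) ⊗ Hom(R_l, ℚ_l)`" in the proof of [AbsTopI] Thm 2.6 (iii)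
(S. Mochizuki, *Topics in Absolute Anabelian Geometry I*, p. 23) — and compatible data `(χ_i)`, `(f_i)`
along `ℤ/l^{i+1} → ℤ/lⁱ` give a family COMPATIBLE under `H¹(G/N, H¹(N, ℤ/l^{i+1})) → H¹(G/N, H¹(N, ℤ/lⁱ))`
(`hOneRepMap` of `HochschildSerreEdgeNaturality.lean`), i.e. exactly the input `(z, hz)` of the
Hochschild–Serre edge assembly `one_le_deltaInv_two_of_hOneRep_family` (`AbsTopILem27HSEdge.lean`).

## Main results (namespace `Literature.NumberTheory.GaloisRepresentations`)

* generic, for a discrete `Γ`-module `V`, an invariant `n`-torsion vector `y` and a continuous additive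
  character `χ : Γ → ℤ/n` (typed as a continuous crossed homomorphism of the trivial module `ℤ/n`):
  `torsionSmulHom` (`ℤ/n → V`, `a ↦ a · y`), `smulCocycle χ y`, `smulClass χ y ∈ H¹(Γ, V)`,
  `cohomologyMap_smulClass` (naturality in `V`, with change of level `ℤ/n′ → ℤ/n`);
* for `N ⊴ G` and trivial `ℤ/lⁱ`: `hOne_of_mem_invariants_of_conj_invariant` (a conjugation-invariant
  continuous hom is a fixed vector of `hOneRep`), `nsmul_hOne_of_eq_zero`, `hOneRepMap_hOne_of`
  (transition = post-composition);
* **`hOneRepSmulFamily χ f`** and **`cohomologyMap_hOneRepMap_hOneRepSmulFamily`**: the compatible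
  family `z_i = [ḡ ↦ χ_i(ḡ) · [f_i]] ∈ H¹(G/N, H¹(N, ℤ/lⁱ))` from compatible characters `χ_i` of `G/N`
  and compatible conjugation-invariant continuous homomorphisms `f_i : N → ℤ/lⁱ`.

Classical, undisputed; nothing here bears on [IUTchIII] Cor. 3.12 (consumer: the «Lemma 2.7 ⇒
Lem27iiiStep» bridge of the refereed [AbsTopI] Thm 2.6 (iii), abc-iut layer L4).

## References
* S. Mochizuki, *Topics in Absolute Anabelian Geometry I* (2012), proof of Thm 2.6 (iii), p. 23.
  [MochizukiAbsTopI2012]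
* J.-P. Serre, *Galois Cohomology* (1997), I §2.3, §2.6. [SerreGaloisCohomology1997]
-/

noncomputable section

open CategoryTheory ContinuousCohomology Function

namespace Literature.NumberTheory.GaloisRepresentations

open _root_.TopRep _root_.Topology _root_.Filter
open Literature.NumberTheory.EllipticCurves (subgroupConj subgroupConj_apply_coe)

/-! ### The cocycle `g ↦ χ(g) · y` of an invariant torsion vector -/

section Smul

variable {Γ : Type} [Group Γ] [TopologicalSpace Γ] [IsTopologicalGroup Γ]
variable {V : Type} [AddCommGroup V] [TopologicalSpace V] [DiscreteTopology V]
variable {V' : Type} [AddCommGroup V'] [TopologicalSpace V'] [DiscreteTopology V']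
variable {τ : ContinuousRep Γ ℤ V} {τ' : ContinuousRep Γ ℤ V'}

/-- `ℤ/n → V`, `a ↦ a · y`, for a vector `y` with `n · y = 0`. [cite: SerreGaloisCohomology1997, I §2.3] -/
def torsionSmulHom (n : ℕ) (y : V) (hny : n • y = 0) : ZMod n →+ V :=
  ZMod.lift n ⟨zmultiplesHom V y, by
    change ((n : ℤ)) • y = 0
    rw [natCast_zsmul, hny]⟩

omit [TopologicalSpace V] [DiscreteTopology V] in
/-- `torsionSmulHom n y (k) = k · y` for an integer `k`. [cite: SerreGaloisCohomology1997, I §2.3] -/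
@[simp] theorem torsionSmulHom_intCast (n : ℕ) (y : V) (hny : n • y = 0) (k : ℤ) :
    torsionSmulHom n y hny (k : ZMod n) = k • y := by
  rw [torsionSmulHom, ZMod.lift_coe]
  rfl

omit [TopologicalSpace V] [DiscreteTopology V] [TopologicalSpace V'] [DiscreteTopology V'] in
/-- An additive map fixing nothing in particular commutes with `torsionSmulHom`: `φ (a · y) = a · φ y`.
[cite: SerreGaloisCohomology1997, I §2.3] -/
theorem map_torsionSmulHom (n : ℕ) (y : V) (hny : n • y = 0) (φ : V →+ V') (hny' : n • φ y = 0)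
    (a : ZMod n) : φ (torsionSmulHom n y hny a) = torsionSmulHom n (φ y) hny' a := by
  obtain ⟨k, rfl⟩ := ZMod.intCast_surjective a
  rw [torsionSmulHom_intCast, torsionSmulHom_intCast, map_zsmul]

omit [TopologicalSpace V] [DiscreteTopology V] in
/-- Change of level: for `n ∣ n'` and `n · y = 0`, `a' · y = (a' mod n) · y` for `a' ∈ ℤ/n'`.
[cite: SerreGaloisCohomology1997, I §2.3] -/
theorem torsionSmulHom_castHom {n n' : ℕ} (h : n ∣ n') (y : V) (hny : n • y = 0) (hn'y : n' • y = 0)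
    (a' : ZMod n') :
    torsionSmulHom n' y hn'y a' = torsionSmulHom n y hny (ZMod.castHom h (ZMod n) a') := by
  obtain ⟨k, rfl⟩ := ZMod.intCast_surjective a'
  rw [torsionSmulHom_intCast, map_intCast, torsionSmulHom_intCast]

variable (τ) in
/-- **The cocycle `g ↦ χ(g) · y`** of `Γ` with values in the discrete `Γ`-module `V`, for a `Γ`-INVARIANT
vector `y` with `n · y = 0` and a continuous additive character `χ : Γ → ℤ/n` (a continuous crossed
homomorphism of the trivial `Γ`-module `ℤ/n`).  Since `y` is fixed it is a continuous homomorphism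
`Γ → V`. [cite: MochizukiAbsTopI2012, Thm 2.6 (iii) proof p.23] -/
def smulCocycle {n : ℕ} (χ : contOneCocycles (ContinuousRep.trivial Γ ℤ (ZMod n)).toTopRep) (y : V)
    (hy : y ∈ τ.toTopRep.ρ.invariants) (hny : n • y = 0) : contOneCocycles τ.toTopRep :=
  ⟨⟨fun g => torsionSmulHom n y hny (χ.1 g),
      (continuous_of_discreteTopology (f := torsionSmulHom n y hny)).comp χ.1.continuous⟩, by
    intro g h
    have hχ : χ.1 (g * h) = χ.1 g + χ.1 h :=
      contOneCocycles.apply_mul_of_trivial (fun _ _ => rfl) χ g h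
    have hfix : ∀ a : ZMod n, τ.toTopRep.ρ g (torsionSmulHom n y hny a) = torsionSmulHom n y hny a := by
      intro a
      obtain ⟨k, rfl⟩ := ZMod.intCast_surjective a
      rw [torsionSmulHom_intCast, map_zsmul]
      exact congrArg (fun v => k • v) (hy g)
    change torsionSmulHom n y hny (χ.1 (g * h)) =
      torsionSmulHom n y hny (χ.1 g) + τ.toTopRep.ρ g (torsionSmulHom n y hny (χ.1 h))
    rw [hχ, map_add, hfix]⟩

omit [IsTopologicalGroup Γ] in
/-- Unfolding `smulCocycle`. [cite: MochizukiAbsTopI2012, Thm 2.6 (iii) proof p.23] -/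
@[simp] theorem smulCocycle_apply {n : ℕ} (χ : contOneCocycles (ContinuousRep.trivial Γ ℤ (ZMod n)).toTopRep)
    (y : V) (hy : y ∈ τ.toTopRep.ρ.invariants) (hny : n • y = 0) (g : Γ) :
    (smulCocycle τ χ y hy hny).1 g = torsionSmulHom n y hny (χ.1 g) := rfl

variable (τ) in
/-- **The class `[g ↦ χ(g) · y] ∈ H¹(Γ, V)`.** [cite: MochizukiAbsTopI2012, Thm 2.6 (iii) proof p.23] -/
def smulClass {n : ℕ} (χ : contOneCocycles (ContinuousRep.trivial Γ ℤ (ZMod n)).toTopRep) (y : V)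
    (hy : y ∈ τ.toTopRep.ρ.invariants) (hny : n • y = 0) : continuousCohomology 1 τ.toTopRep :=
  oneCocycleClass _ (smulCocycle τ χ y hy hny)

/-- `smulClass` depends only on the vector (proof-irrelevance helper).
[cite: SerreGaloisCohomology1997, I §2.3] -/
theorem smulClass_congr {n : ℕ} (χ : contOneCocycles (ContinuousRep.trivial Γ ℤ (ZMod n)).toTopRep)
    {y y' : V} (e : y = y') (hy : y ∈ τ.toTopRep.ρ.invariants) (hny : n • y = 0)
    (hy' : y' ∈ τ.toTopRep.ρ.invariants) (hny' : n • y' = 0) :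
    smulClass τ χ y hy hny = smulClass τ χ y' hy' hny' := by
  subst e
  rfl

/-- **Naturality of `smulClass` in the module, with change of level**: for a morphism `φ : V → V'` of
discrete `Γ`-modules, `n ∣ n'`, a character `χ' : Γ → ℤ/n'` with reduction `χ : Γ → ℤ/n`, and an
invariant `n'`-torsion `y ∈ V` whose image `φ y` is `n`-torsion:
`H¹(φ) [χ' · y] = [χ · φ y]`. [cite: MochizukiAbsTopI2012, Thm 2.6 (iii) proof p.23] -/
theorem cohomologyMap_smulClass (φ : τ.toTopRep ⟶ τ'.toTopRep) {n n' : ℕ} (h : n ∣ n')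
    (χ' : contOneCocycles (ContinuousRep.trivial Γ ℤ (ZMod n')).toTopRep)
    (χ : contOneCocycles (ContinuousRep.trivial Γ ℤ (ZMod n)).toTopRep)
    (hχ : ∀ g, χ.1 g = ZMod.castHom h (ZMod n) (χ'.1 g))
    (y : V) (hy : y ∈ τ.toTopRep.ρ.invariants) (hn'y : n' • y = 0)
    (hy' : φ.hom y ∈ τ'.toTopRep.ρ.invariants) (hny' : n • φ.hom y = 0) :
    cohomologyMap φ 1 (smulClass τ χ' y hy hn'y) = smulClass τ' χ (φ.hom y) hy' hny' := by
  rw [smulClass, smulClass, cohomologyMap_oneCocycleClass]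
  refine congrArg _ (Subtype.ext (ContinuousMap.ext fun g => ?_))
  rw [pullback_id_resIdHom_apply, smulCocycle_apply, smulCocycle_apply, hχ]
  obtain ⟨k, hk⟩ := ZMod.intCast_surjective (χ'.1 g)
  rw [← hk, torsionSmulHom_intCast, map_intCast, torsionSmulHom_intCast, map_zsmul]

end Smul

/-! ### `H¹(N, ℤ/lⁱ)` with trivial coefficients: invariant homomorphisms, torsion, transitions -/

section Trivial

variable {G : Type} [Group G] [TopologicalSpace G] [IsTopologicalGroup G] [CompactSpace G] [T2Space G]
  [TotallyDisconnectedSpace G]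
variable (N : Subgroup G) [N.Normal] [hN : IsClosed (N : Set G)]
variable {A : Type} [AddCommGroup A] [TopologicalSpace A] [DiscreteTopology A]
variable {A' : Type} [AddCommGroup A'] [TopologicalSpace A'] [DiscreteTopology A']

/-- The class in `H¹(N, A)` (carrier `HOne`) of a continuous crossed homomorphism of the (restricted,
trivial) module — for trivial `A` these are the continuous homomorphisms `N → A`.
[cite: SerreGaloisCohomology1997, I §2.3] -/
abbrev hOneOf (f : contOneCocycles (((ContinuousRep.trivial G ℤ A).restrict (subgroupIncl N)).toTopRep)) :
    HOne N (ContinuousRep.trivial G ℤ A) :=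
  HOne.of N _ (oneCocycleClass _ f)

omit [CompactSpace G] [T2Space G] [TotallyDisconnectedSpace G] [N.Normal] hN in
/-- `f ↦ [f]` is injective for trivial coefficients (`H¹(N, A) = Hom_cont(N, A)`).
[cite: SerreGaloisCohomology1997, I §2.3] -/
theorem hOneOf_injective :
    Injective (hOneOf (G := G) N (A := A)) :=
  (HOne.of N _).injective.comp (oneCocycleClass_injective_of_trivial _ fun _ _ => rfl)

omit [T2Space G] in
/-- **A conjugation-invariant continuous homomorphism `f : N → A` (`f(g⁻¹ n g) = f(n)`) is a `G/N`-fixed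
vector of `H¹(N, A)`** (trivial coefficients). [cite: SerreGaloisCohomology1997, I §2.6] -/
theorem hOneOf_mem_invariants
    (f : contOneCocycles (((ContinuousRep.trivial G ℤ A).restrict (subgroupIncl N)).toTopRep))
    (hf : ∀ (g : G) (n : N), f.1 (subgroupConj N g n) = f.1 n) :
    hOneOf N f ∈ (hOneRep N (ContinuousRep.trivial G ℤ A)).toTopRep.ρ.invariants := by
  rw [mem_invariants_hOneRep_iff]
  intro g
  rw [hOneOf, AddEquiv.symm_apply_apply]
  have e : conjMap (ContinuousRep.trivial G ℤ A).toTopRep N g 1 (oneCocycleClass _ f) =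
      oneCocycleClass _ (contOneCocycles.pullback (subgroupConj N g)
        (conjRepHom (ContinuousRep.trivial G ℤ A).toTopRep N g) f) :=
    map_oneCocycleClass _ _ _ _
  exact e.trans (congrArg _ (Subtype.ext (ContinuousMap.ext fun n => hf g n)))

omit [CompactSpace G] [T2Space G] [TotallyDisconnectedSpace G] [N.Normal] hN in
/-- If `m · A = 0` then `m · [f] = 0` in `H¹(N, A)`. [cite: SerreGaloisCohomology1997, I §2.3] -/
theorem nsmul_hOneOf_eq_zero {m : ℕ} (hm : ∀ a : A, m • a = 0)
    (f : contOneCocycles (((ContinuousRep.trivial G ℤ A).restrict (subgroupIncl N)).toTopRep)) :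
    m • hOneOf N f = 0 := by
  have h0 : m • f = 0 := Subtype.ext (ContinuousMap.ext fun n => hm (f.1 n))
  have h1 : m • oneCocycleClass _ f = oneCocycleClass _ (m • f) :=
    (map_nsmul (oneCocycleClassₗ _) m f).symm
  rw [hOneOf, ← map_nsmul, h1, h0]
  change HOne.of N _ (oneCocycleClassₗ _ 0) = 0
  rw [map_zero, map_zero]

omit [T2Space G] in
/-- **Transitions are post-composition**: for a morphism `φ : A → A'` of trivial `G`-modules,
`hOneRepMap N φ [f] = [φ ∘ f]`. [cite: SerreGaloisCohomology1997, I §2.6] -/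
theorem hOneRepMap_hOneOf (φ : (ContinuousRep.trivial G ℤ A).toTopRep ⟶ (ContinuousRep.trivial G ℤ A').toTopRep)
    (f : contOneCocycles (((ContinuousRep.trivial G ℤ A).restrict (subgroupIncl N)).toTopRep)) :
    (hOneRepMap N φ).hom (hOneOf N f) =
      hOneOf N (contOneCocycles.pullback (ContinuousMonoidHom.id N) (resIdHom (restrictHom N φ)) f) := by
  rw [hOneRepMap_hom_apply, hOneOf, AddEquiv.symm_apply_apply, cohomologyMap_oneCocycleClass]

end Trivial

/-! ### The compatible families `z_i = [ḡ ↦ χ_i(ḡ) · [f_i]]` -/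

section Family

variable {G : Type} [Group G] [TopologicalSpace G] [IsTopologicalGroup G] [CompactSpace G] [T2Space G]
  [TotallyDisconnectedSpace G]
variable (N : Subgroup G) [N.Normal] [hN : IsClosed (N : Set G)]
variable (l : ℕ)

/-- **The `E₂^{1,1}`-class `z_i = [ḡ ↦ χ_i(ḡ) · [f_i]] ∈ H¹(G/N, H¹(N, ℤ/lⁱ))`** attached to a continuous
additive character `χ_i : G/N → ℤ/lⁱ` and a conjugation-invariant continuous homomorphism
`f_i : N → ℤ/lⁱ` (the decomposable classes `χ ⊗ f` of "`H¹(G, Hom(R_l, ℚ_l)) = H¹(G, ℚ_l) ⊗ Hom(R_l, ℚ_l)`",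
[AbsTopI] p. 23, at level `lⁱ`). [cite: MochizukiAbsTopI2012, Thm 2.6 (iii) proof p.23] -/
def hOneRepSmulClass (i : ℕ)
    (χ : contOneCocycles (ContinuousRep.trivial (G ⧸ N) ℤ (ZMod (l ^ i))).toTopRep)
    (f : contOneCocycles (((ContinuousRep.trivial G ℤ (ZMod (l ^ i))).restrict (subgroupIncl N)).toTopRep))
    (hf : ∀ (g : G) (n : N), f.1 (subgroupConj N g n) = f.1 n) :
    continuousCohomology 1 (hOneRep N (ContinuousRep.trivial G ℤ (ZMod (l ^ i)))).toTopRep :=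
  smulClass (hOneRep N (ContinuousRep.trivial G ℤ (ZMod (l ^ i)))) χ (hOneOf N f)
    (hOneOf_mem_invariants N f hf)
    (nsmul_hOneOf_eq_zero N (fun a => by rw [nsmul_eq_mul, ZMod.natCast_self, zero_mul]) f)

omit [T2Space G] in
/-- **Compatibility of the classes `z_i` along `ℤ/l^{i+1} → ℤ/lⁱ`**: if `χ_i = χ_{i+1} mod lⁱ` and
`f_i = f_{i+1} mod lⁱ` pointwise, then `H¹(G/N, H¹(N, red)) z_{i+1} = z_i` — the hypothesis `hz` of
`one_le_deltaInv_two_of_hOneRep_family` / `…_of_isOpen` (with `zmodTrivRep l i = trivial ℤ/lⁱ`).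
[cite: MochizukiAbsTopI2012, Thm 2.6 (iii) proof p.23] -/
theorem cohomologyMap_hOneRepMap_hOneRepSmulClass (i : ℕ)
    (χ' : contOneCocycles (ContinuousRep.trivial (G ⧸ N) ℤ (ZMod (l ^ (i + 1)))).toTopRep)
    (χ : contOneCocycles (ContinuousRep.trivial (G ⧸ N) ℤ (ZMod (l ^ i))).toTopRep)
    (hχ : ∀ q, χ.1 q = ZMod.castHom (pow_dvd_pow l (Nat.le_succ i)) (ZMod (l ^ i)) (χ'.1 q))
    (f' : contOneCocycles (((ContinuousRep.trivial G ℤ (ZMod (l ^ (i + 1)))).restrict (subgroupIncl N)).toTopRep))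
    (f : contOneCocycles (((ContinuousRep.trivial G ℤ (ZMod (l ^ i))).restrict (subgroupIncl N)).toTopRep))
    (hff : ∀ n : N, f.1 n = ZMod.castHom (pow_dvd_pow l (Nat.le_succ i)) (ZMod (l ^ i)) (f'.1 n))
    (hf' : ∀ (g : G) (n : N), f'.1 (subgroupConj N g n) = f'.1 n)
    (hf : ∀ (g : G) (n : N), f.1 (subgroupConj N g n) = f.1 n) :
    cohomologyMap (hOneRepMap N (zmodTr G l i)) 1 (hOneRepSmulClass N l (i + 1) χ' f' hf') =
      hOneRepSmulClass N l i χ f hf := by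
  have hfeq : hOneOf N f =
      (hOneRepMap N (zmodTr G l i)).hom (hOneOf N f') := by
    rw [hOneRepMap_hOneOf]
    refine congrArg (hOneOf N) (Subtype.ext (ContinuousMap.ext fun n => ?_))
    rw [contOneCocycles.pullback_apply]
    exact hff n
  have hy' : (hOneRepMap N (zmodTr G l i)).hom (hOneOf N f') ∈
      (hOneRep N (ContinuousRep.trivial G ℤ (ZMod (l ^ i)))).toTopRep.ρ.invariants := by
    rw [← hfeq]; exact hOneOf_mem_invariants N f hf
  have hny' : l ^ i • (hOneRepMap N (zmodTr G l i)).hom (hOneOf N f') = 0 := by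
    rw [← hfeq]
    exact nsmul_hOneOf_eq_zero N (fun a => by rw [nsmul_eq_mul, ZMod.natCast_self, zero_mul]) f
  rw [hOneRepSmulClass, hOneRepSmulClass,
    cohomologyMap_smulClass (hOneRepMap N (zmodTr G l i)) (pow_dvd_pow l (Nat.le_succ i)) χ' χ hχ
      (hOneOf N f') _ _ hy' hny']
  exact smulClass_congr χ hfeq.symm _ _ _ _

omit [T2Space G] in
/-- **The compatible family** `(z_i)_i` from compatible characters `(χ_i)` of `G/N` and compatible
conjugation-invariant continuous homomorphisms `(f_i : N → ℤ/lⁱ)`: the input `(z, hz)` of the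
Hochschild–Serre edge assembly. [cite: MochizukiAbsTopI2012, Thm 2.6 (iii) proof p.23] -/
theorem hOneRepSmulClass_compatible
    (χ : ∀ i : ℕ, contOneCocycles (ContinuousRep.trivial (G ⧸ N) ℤ (ZMod (l ^ i))).toTopRep)
    (hχ : ∀ i q, (χ i).1 q = ZMod.castHom (pow_dvd_pow l (Nat.le_succ i)) (ZMod (l ^ i)) ((χ (i + 1)).1 q))
    (f : ∀ i : ℕ, contOneCocycles
      (((ContinuousRep.trivial G ℤ (ZMod (l ^ i))).restrict (subgroupIncl N)).toTopRep))
    (hff : ∀ i (n : N), (f i).1 n = ZMod.castHom (pow_dvd_pow l (Nat.le_succ i)) (ZMod (l ^ i)) ((f (i + 1)).1 n))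
    (hf : ∀ i (g : G) (n : N), (f i).1 (subgroupConj N g n) = (f i).1 n) (i : ℕ) :
    cohomologyMap (hOneRepMap N (zmodTr G l i)) 1 (hOneRepSmulClass N l (i + 1) (χ (i + 1)) (f (i + 1)) (hf (i + 1))) =
      hOneRepSmulClass N l i (χ i) (f i) (hf i) :=
  cohomologyMap_hOneRepMap_hOneRepSmulClass N l i (χ (i + 1)) (χ i) (hχ i) (f (i + 1)) (f i) (hff i)
    (hf (i + 1)) (hf i)

end Family

end Literature.NumberTheory.GaloisRepresentations

end
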